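import Literature.Barriers.CriticalPhenomena.RigorousRGSmallParameterTorusDecomposition
import Literature.Barriers.CriticalPhenomena.RigorousRGSmallParameterCovarianceDecomposition
import HarnessLib

/-!
# `RigorousRGSmallParameter` (Slade, Theorem 1.4.1): the finite-range decomposition of the
# torus covariance, `((-Δ_Λ)^{α/2}+m²)⁻¹ = Σ_{j<N} C_j + C_{N,N}` (Slade (3.7)–(3.8) on `Λ_N`)

Companion of `RigorousRGSmallParameterTorusDecomposition.lean` ((3.4)–(3.5): `Γ_{N,N}` and
`(-Δ_Λ+s)⁻¹ = Σ_{j<N}Γ_j + Γ_{N,N}`) and `RigorousRGSmallParameterCovarianceDecomposition.lean`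
(integrability of `Γ_j(s)ρ(s,m²)`, (3.7) on `ℤ^d`) in the proof architecture of the barrier
`RigorousRGSmallParameter.lean`. Source: G. Slade, *Critical exponents for long-range `O(n)`
models below the upper critical dimension*, Commun. Math. Phys. 358 (2018) 343–436, §3.2:
"By (2.16), (3.6) `C_{0,x} = ∫₀^∞ (-Δ_Λ+s)⁻¹_{0x} ρ^{(α/2)}(s,m²) ds`. As in [Mitt16], we obtain
a finite-range positive-definite covariance decomposition by inserting (3.5) into (3.6), namely
(3.7) `((-Δ_Λ)^{α/2}+m²)⁻¹ = Σ_{j=1}^{N-1} C_j + C_{N,N}`, with (3.8) `C_{j;0,x} =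
∫₀^∞ Γ_{j;0,x}(s) ρ^{(α/2)}(s,m²) ds`, `C_{N,N;0,x} = ∫₀^∞ Γ_{N,N;0,x}(s) ρ^{(α/2)}(s,m²) ds`.
This is valid whenever we have a decomposition for strictly positive `s > 0`, i.e., for all
`d ≥ 1`. Again it is the case that `C_j` serves as a term in the decomposition of the `ℤ^d`
covariance as well as in the torus covariance when `j < N`, and again the effect of the torus is
concentrated in the term `C_{N,N}`."

## What this file provides

* `FRD.torusResolvent_hasSum`, `FRD.torusResolvent_nonneg`, `FRD.torusResolvent_le_inv`,
  `FRD.integrableOn_torusResolvent_mul_katoDensity` — `0 ≤ (-Δ_Λ+s)⁻¹_{x,y} ≤ s⁻¹` (a sub-sum of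
  a resolvent row) and integrability of `(-Δ_Λ+s)⁻¹_{x,y}ρ(s,m²)` on `(0,∞)` (`m² > 0`).
* `FRD.finite_periodiseIndex`, `FRD.periodise_Gam_eq_sum`,
  `FRD.integrableOn_periodise_Gam_mul_katoDensity` — the periodisation of `Γ_j(s)` is a FIXED
  finite sum of translates (finite range), hence integrable against `ρ`.
* `FRD.fracCovNN d L α m2 N M x y` — **`C_{N,N;x,y}(m²) = ∫₀^∞ Γ_{N,N;x,y}(s)ρ^{(α/2)}(s,m²)ds`**
  (Slade (3.8), second half; definition with body), `FRD.integrableOn_GamNN_mul_katoDensity`.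
* **`FRD.Slade2017_display37_torus`** — **(3.7) on the torus, PROVED**:
  `((-Δ_Λ)^{α/2}+m²)⁻¹_{x,y} = Σ_{j=1}^{N-1} ∫₀^∞(Γ_j)^Λ_{x,y}(s)ρ ds + C_{N,N;x,y}` for `d ≥ 1`,
  `α ∈ (0,2)`, `m² > 0`, `L > 1`, `N ≥ 1`, any torus side `M ≥ 1`; and
  **`FRD.Slade2017_display37_torus_rep`** — the same with the `j < N` terms identified with the
  `ℤ^d` terms `C_j(a-b) = FRD.fracCov` at representatives `a, b` with `|a-b|₁ < R`,
  `½L^{N-1} ≤ R`, `2R ≤ M` ("`C_j` serves as a term in the decomposition of the `ℤ^d` covariance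
  as well as in the torus covariance when `j < N`").

No named fact is introduced. Not treated: the estimate (3.10) on `C_{N,N}`.
-/

noncomputable section

namespace Literature.Barriers.CriticalPhenomena

open _root_.MeasureTheory Set Filter
open scoped _root_.Topology Real

namespace LongRangePhi4

namespace FRD

open Literature.Probability.LatticeModels

variable {d : ℕ}

/-! ### The torus resolvent `(-Δ_Λ+s)⁻¹`: `0 ≤ · ≤ s⁻¹`, integrability against `ρ` -/

/-- `(-Δ_Λ+s)⁻¹_{x,y} = Σ_z (-Δ+s)⁻¹_{x̃,ỹ+Mz}` as a convergent series ((3.2) entrywise).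
[cite: Slade2017, §3.1 (display (3.2))] -/
theorem torusResolvent_hasSum (hd : 1 ≤ d) {M : ℕ} [NeZero M] {s : ℝ} (hs : 0 < s)
    (x y : TorusSite d M) :
    HasSum (fun z : Site d => resolventZd d s (fun j => ((x j).val : ℤ))
      (fun j => ((y j).val : ℤ) + M * z j)) ((covInvMatrix d 1 M s)⁻¹ x y) := by
  rw [Slade2017_torusLaplaceResolvent hd hs, Matrix.of_apply]
  exact hasSum_periodise (resolventZd d s) x y (hasSum_resolventZd_row hd hs _).summable

/-- `(-Δ_Λ+s)⁻¹_{x,y} ≥ 0`. [folklore] -/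
theorem torusResolvent_nonneg (hd : 1 ≤ d) {M : ℕ} [NeZero M] {s : ℝ} (hs : 0 < s)
    (x y : TorusSite d M) : 0 ≤ (covInvMatrix d 1 M s)⁻¹ x y :=
  (torusResolvent_hasSum hd hs x y).nonneg fun _ => resolventZd_nonneg hd hs _ _

/-- **`(-Δ_Λ+s)⁻¹_{x,y} ≤ s⁻¹`** (a sub-sum of the row `Σ_w(-Δ+s)⁻¹_{x̃,w} = s⁻¹`).
[cite: Slade2017, §3.1 (display (3.2)) and §2.1.2 (display (2.14))] -/
theorem torusResolvent_le_inv (hd : 1 ≤ d) {M : ℕ} [NeZero M] {s : ℝ} (hs : 0 < s)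
    (x y : TorusSite d M) : (covInvMatrix d 1 M s)⁻¹ x y ≤ s⁻¹ := by
  have hrow := hasSum_resolventZd_row hd hs (fun j => ((x j).val : ℤ))
  have hinj : Function.Injective fun z : Site d => (fun j => ((y j).val : ℤ) + M * z j : Site d) := by
    intro z₁ z₂ h
    funext j
    have hj := congr_fun h j
    simpa [NeZero.ne M] using hj
  rw [← (torusResolvent_hasSum hd hs x y).tsum_eq, ← one_div, ← hrow.tsum_eq]
  exact tsum_comp_le_tsum_of_inj hrow.summable (fun w => resolventZd_nonneg hd hs _ _) hinj

/-- `s ↦ (-Δ_Λ+s)⁻¹_{x,y}ρ^{(β)}(s,m²)` is integrable on `(0,∞)` (`m² > 0`): a.e. equal to a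
measurable series and dominated by `s⁻¹ρ(s,m²)`. [cite: Slade2017, §3.2 (display (3.6))] -/
theorem integrableOn_torusResolvent_mul_katoDensity (hd : 1 ≤ d) {M : ℕ} [NeZero M] {β : ℝ}
    (hβ0 : 0 < β) (hβ1 : β < 1) {m2 : ℝ} (hm2 : 0 < m2) (x y : TorusSite d M) :
    IntegrableOn (fun s : ℝ => (covInvMatrix d 1 M s)⁻¹ x y * Kato.katoDensity β m2 s) (Ioi 0) := by
  set g : ℝ → ℝ := fun s => (∑' z : Site d, resolventZd d s (fun j => ((x j).val : ℤ))
    (fun j => ((y j).val : ℤ) + M * z j)) * Kato.katoDensity β m2 s with hg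
  have hgm : Measurable g :=
    (Measurable.tsum fun z => measurable_resolventZd _ _).mul (Kato.measurable_katoDensity β m2)
  have hae : (fun s : ℝ => (covInvMatrix d 1 M s)⁻¹ x y * Kato.katoDensity β m2 s) =ᵐ[
      (volume : Measure ℝ).restrict (Ioi 0)] g :=
    (ae_restrict_iff' measurableSet_Ioi).2 (Eventually.of_forall fun s hs => by
      simp only [hg]
      rw [(torusResolvent_hasSum hd hs x y).tsum_eq])
  refine Integrable.mono' (integrableOn_inv_mul_katoDensity hβ0 hβ1 hm2)
    (hgm.aestronglyMeasurable.congr hae.symm)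
    ((ae_restrict_iff' measurableSet_Ioi).2 (Eventually.of_forall fun s hs => ?_))
  have hs : (0 : ℝ) < s := hs
  have hρ0 := (Kato.katoDensity_pos hβ0 hβ1 m2 hs).le
  rw [Real.norm_eq_abs, abs_mul, abs_of_nonneg hρ0, abs_of_nonneg (torusResolvent_nonneg hd hs x y)]
  exact mul_le_mul_of_nonneg_right (torusResolvent_le_inv hd hs x y) hρ0

/-! ### The periodisation of `Γ_j(s)` is a fixed finite sum -/

/-- The translates entering the periodisation of a kernel of range `< R` at `(x,y)` form a
finite set (independent of `s`). [folklore] -/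
theorem finite_periodiseIndex {M : ℕ} [NeZero M] (x y : TorusSite d M) (R : ℝ) :
    {z : Site d | (((∑ i, (((fun j => ((x j).val : ℤ)) - fun j => ((y j).val : ℤ) + M * z j) i).natAbs
      : ℕ) : ℝ)) < R}.Finite := by
  have hinj : Function.Injective fun z : Site d =>
      ((fun j => ((x j).val : ℤ)) - fun j => ((y j).val : ℤ) + M * z j : Site d) := by
    intro z₁ z₂ h
    funext j
    have hj := congr_fun h j
    simp only [Pi.sub_apply] at hj
    have hM : (M : ℤ) ≠ 0 := by exact_mod_cast NeZero.ne M
    have : (M : ℤ) * z₁ j = M * z₂ j := by linarith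
    exact mul_left_cancel₀ hM this
  exact (finite_l1Ball R).preimage hinj.injOn

/-- **The periodisation of `Γ_j(s)` is a fixed finite sum of translates**: with `Z₀` the finite
set of `z` with `|x̃-ỹ-Mz|₁ < ½L^j`, `(Γ_j)^Λ_{x,y}(s) = Σ_{z∈Z₀} Γ_j(x̃-ỹ-Mz)(s)` for every
`s ≥ 0` (finite range (3.1)). [cite: Slade2017, §3.1 (displays (3.1), (3.3))] -/
theorem periodise_Gam_eq_sum (hd : 1 ≤ d) {M : ℕ} [NeZero M] {L : ℝ} (hL : 0 ≤ L) {s : ℝ}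
    (hs : 0 ≤ s) (j : ℕ) (x y : TorusSite d M) :
    periodise M (fun a b => Gam d L s j (a - b)) x y =
      ∑ z ∈ (finite_periodiseIndex x y (L ^ j / 2)).toFinset,
        Gam d L s j ((fun i => ((x i).val : ℤ)) - fun i => ((y i).val : ℤ) + M * z i) := by
  have h := hasSum_periodise (fun a b => Gam d L s j (a - b)) x y (summable_Gam_sub hd hL hs j _)
  rw [← h.tsum_eq]
  refine tsum_eq_sum fun z hz => ?_
  rw [Set.Finite.mem_toFinset] at hz
  exact Gam_eq_zero hd hL hs j _ (not_lt.1 hz)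

/-- `s ↦ (Γ_j)^Λ_{x,y}(s)ρ^{(β)}(s,m²)` is integrable on `(0,∞)` (`m² > 0`, `L > 1`, `j ≥ 1`).
[cite: Slade2017, §3.2 (display (3.8))] -/
theorem integrableOn_periodise_Gam_mul_katoDensity (hd : 1 ≤ d) {M : ℕ} [NeZero M] {β : ℝ}
    (hβ0 : 0 < β) (hβ1 : β < 1) {L : ℝ} (hL : 1 < L) {m2 : ℝ} (hm2 : 0 < m2) {j : ℕ} (hj : 1 ≤ j)
    (x y : TorusSite d M) :
    IntegrableOn (fun s : ℝ => periodise M (fun a b => Gam d L s j (a - b)) x y *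
      Kato.katoDensity β m2 s) (Ioi 0) := by
  have hL0 : (0 : ℝ) ≤ L := zero_le_one.trans hL.le
  set Z₀ := (finite_periodiseIndex x y (L ^ j / 2)).toFinset with hZ₀
  have he : EqOn (fun s : ℝ => periodise M (fun a b => Gam d L s j (a - b)) x y *
      Kato.katoDensity β m2 s) (fun s => ∑ z ∈ Z₀,
        Gam d L s j ((fun i => ((x i).val : ℤ)) - fun i => ((y i).val : ℤ) + M * z i) *
          Kato.katoDensity β m2 s) (Ioi 0) := fun s hs => by
    simp only
    rw [periodise_Gam_eq_sum hd hL0 (le_of_lt hs) j x y, Finset.sum_mul]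
  refine IntegrableOn.congr_fun ?_ he.symm measurableSet_Ioi
  exact integrable_finsetSum Z₀ fun z _ => integrableOn_Gam_mul_katoDensity hd hβ0 hβ1 hL hm2 hj _

/-! ### `C_{N,N}` and (3.7) on the torus -/

/-- **`C_{N,N;x,y}(m²) = ∫₀^∞ Γ_{N,N;x,y}(s) ρ^{(α/2)}(s,m²) ds`** (Slade (3.8), second half; on
the torus of side `M`, Slade's `M = L^N`). [cite: Slade2017, §3.2 (display (3.8), C_{N,N})] -/
def fracCovNN (d : ℕ) (L α m2 : ℝ) (N M : ℕ) (x y : TorusSite d M) : ℝ :=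
  ∫ s in Ioi 0, GamNN d L s N M x y * Kato.katoDensity (α / 2) m2 s

/-- `s ↦ Γ_{N,N;x,y}(s)ρ^{(β)}(s,m²)` is integrable on `(0,∞)` (`m² > 0`): by (3.5) it is the
torus resolvent term minus finitely many `Γ_j` terms. [cite: Slade2017, §3.2 (display (3.8))] -/
theorem integrableOn_GamNN_mul_katoDensity (hd : 1 ≤ d) {M : ℕ} [NeZero M] {β : ℝ}
    (hβ0 : 0 < β) (hβ1 : β < 1) {L : ℝ} (hL : 1 < L) {m2 : ℝ} (hm2 : 0 < m2) {N : ℕ} (hN : 1 ≤ N)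
    (x y : TorusSite d M) :
    IntegrableOn (fun s : ℝ => GamNN d L s N M x y * Kato.katoDensity β m2 s) (Ioi 0) := by
  have he : EqOn (fun s : ℝ => GamNN d L s N M x y * Kato.katoDensity β m2 s)
      (fun s => (covInvMatrix d 1 M s)⁻¹ x y * Kato.katoDensity β m2 s -
        ∑ m ∈ Finset.range (N - 1), periodise M (fun a b => Gam d L s (m + 1) (a - b)) x y *
          Kato.katoDensity β m2 s) (Ioi 0) := fun s hs => by
    simp only
    rw [Slade2017_display35 hd hL hs hN x y, ← Finset.sum_mul]
    ring
  refine IntegrableOn.congr_fun ?_ he.symm measurableSet_Ioi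
  exact (integrableOn_torusResolvent_mul_katoDensity hd hβ0 hβ1 hm2 x y).sub
    (integrable_finsetSum _ fun m _ =>
      integrableOn_periodise_Gam_mul_katoDensity hd hβ0 hβ1 hL hm2 (Nat.succ_le_succ (Nat.zero_le m)) x y)

/-- **Slade, display (3.7) on the torus, PROVED**: for `d ≥ 1`, `α ∈ (0,2)`, `m² > 0`, `L > 1`,
`N ≥ 1`, any torus `Λ = (ℤ/Mℤ)^d` and all `x, y ∈ Λ`,
`((-Δ_Λ)^{α/2}+m²)⁻¹_{x,y} = Σ_{j=1}^{N-1} ∫₀^∞ (Γ_j)^Λ_{x,y}(s) ρ^{(α/2)}(s,m²) ds + C_{N,N;x,y}`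
— "inserting (3.5) into (3.6)". [cite: Slade2017, §3.2 (display (3.7))] -/
theorem Slade2017_display37_torus (hd : 1 ≤ d) {M : ℕ} [NeZero M] {α : ℝ} (hα0 : 0 < α)
    (hα2 : α < 2) {L : ℝ} (hL : 1 < L) {m2 : ℝ} (hm2 : 0 < m2) {N : ℕ} (hN : 1 ≤ N)
    (x y : TorusSite d M) :
    (covInvMatrix d (α / 2) M m2)⁻¹ x y =
      (∑ m ∈ Finset.range (N - 1), ∫ s in Ioi 0,
        periodise M (fun a b => Gam d L s (m + 1) (a - b)) x y * Kato.katoDensity (α / 2) m2 s) +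
        fracCovNN d L α m2 N M x y := by
  have hβ0 : 0 < α / 2 := by positivity
  have hβ1 : α / 2 < 1 := by linarith
  rw [Slade2017_torusCovariance_katoMixture hd hβ0 hβ1 hm2 x y]
  have he : EqOn (fun s : ℝ => (covInvMatrix d 1 M s)⁻¹ x y * Kato.katoDensity (α / 2) m2 s)
      (fun s => (∑ m ∈ Finset.range (N - 1),
        periodise M (fun a b => Gam d L s (m + 1) (a - b)) x y * Kato.katoDensity (α / 2) m2 s) +
          GamNN d L s N M x y * Kato.katoDensity (α / 2) m2 s) (Ioi 0) := fun s hs => by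
    simp only
    rw [Slade2017_display35 hd hL hs hN x y, ← Finset.sum_mul]
    ring
  rw [setIntegral_congr_fun measurableSet_Ioi he, integral_add (integrable_finsetSum _ fun m _ =>
      integrableOn_periodise_Gam_mul_katoDensity hd hβ0 hβ1 hL hm2 (Nat.succ_le_succ (Nat.zero_le m)) x y)
    (integrableOn_GamNN_mul_katoDensity hd hβ0 hβ1 hL hm2 hN x y),
    integral_finsetSum _ fun m _ =>
      integrableOn_periodise_Gam_mul_katoDensity hd hβ0 hβ1 hL hm2 (Nat.succ_le_succ (Nat.zero_le m)) x y]
  rfl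

/-- **(3.7) on the torus with the `j < N` terms identified with the `ℤ^d` covariances `C_j`**
("`C_j` serves as a term in the decomposition of the `ℤ^d` covariance as well as in the torus
covariance when `j < N`"): if `½L^{N-1} ≤ R` and `2R ≤ M`, then for representatives `a, b ∈ ℤ^d`
with `|a-b|₁ < R`,
`((-Δ_Λ)^{α/2}+m²)⁻¹_{a,b} = Σ_{j=1}^{N-1} C_j(a-b)(m²) + C_{N,N;a,b}(m²)`.
[cite: Slade2017, §3.2 (display (3.7) and the sentence following (3.8))] -/
theorem Slade2017_display37_torus_rep (hd : 1 ≤ d) {M : ℕ} [NeZero M] {α : ℝ} (hα0 : 0 < α)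
    (hα2 : α < 2) {L : ℝ} (hL : 1 < L) {m2 : ℝ} (hm2 : 0 < m2) {N : ℕ} (hN : 1 ≤ N) {R : ℕ}
    (hR : L ^ (N - 1) / 2 ≤ R) (hM : 2 * R ≤ M) (a b : Site d)
    (hab : (∑ i, ((a - b) i).natAbs) < R) :
    (covInvMatrix d (α / 2) M m2)⁻¹ (fun i => (a i : ZMod M)) (fun i => (b i : ZMod M)) =
      (∑ m ∈ Finset.range (N - 1), fracCov d L α m2 (m + 1) (a - b)) +
        fracCovNN d L α m2 N M (fun i => (a i : ZMod M)) (fun i => (b i : ZMod M)) := by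
  rw [Slade2017_display37_torus hd hα0 hα2 hL hm2 hN]
  congr 1
  refine Finset.sum_congr rfl fun m hm => ?_
  unfold fracCov
  refine setIntegral_congr_fun measurableSet_Ioi fun s hs => ?_
  have hL0 : (0 : ℝ) ≤ L := zero_le_one.trans hL.le
  have hm' : m + 1 ≤ N - 1 := Nat.succ_le_of_lt (Finset.mem_range.1 hm)
  have hRj : L ^ (m + 1) / 2 ≤ R := by
    refine le_trans (div_le_div_of_nonneg_right (pow_le_pow_right₀ hL.le hm') (by norm_num)) hR
  rw [Slade2017_display33_Gam hd hL0 (le_of_lt hs) (m + 1) hRj hM a b hab]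

end FRD

end LongRangePhi4

end Literature.Barriers.CriticalPhenomena
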